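import Summits.BirchSwinnertonDyer.BirchSwinnertonDyer.Theorems.TwoAdicConverseTwoTorsionIsogenyPairs
import HarnessLib

/-!
# Route `TwoAdicConverse` (rung S3), items 19218 / 24404 (and KRR2's residual 24303): the `r ≤ 1` LEAF SHAPE of
# the rational-`2`-torsion stratum (β) at a good ordinary `2` also shrinks to the two Greenberg configurations

Cell `bsd-2adic`, seat `bsd-2adic-conv-1` (GEN 19).  THEOREMS ONLY; `--supports stmt-BirchSwinnertonDyer-19218`.
HONEST FRAMING: BSD is not proved by any of this; the `r = 1` off-habitat converse (item 24404, KRR2's residual 24303)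
and 19218 stay OPEN; this file only re-keys the good-ordinary rational-`2`-torsion binder of the `r ≤ 1` leaf shape
(`hβ` of conv-1 GEN 18's `offHabitatNonSurjTwoConverse_of_goodOrd_three_strata_of_mult` /
`h2t` of `leaf_offBigImage_of_strata` restricted to good ordinary `2`) to the (M) «∃ Prop-5.14 point» and (R)
«∃ Prop-5.13 point» configurations, exactly as `goodOrd_twoTorsion_rankZero_of_mixed_of_ramifiedOdd` did for
`r = 0`: the `ℤ/2`-linked pair transports `corank = r ⟹ r_an = r` for every `r`
(`twoConverseAt_iff_of_twoTorsionPair`).  PARTITION (D-0054): none — RANK axis (S3/KRR2 residual) × (β).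

* `goodOrd_twoTorsion_leaf_of_mixed_of_ramifiedOdd` — (M-leaf) ∧ (R-leaf) ⟹ the (β) good-ordinary `r ≤ 1` piece;
  «neither» is eliminated along the pair.
* `goodOrd_twoTorsion_rankOne_of_mixed_of_ramifiedOdd` — the `r = 1` instance (item 24404's (β) good-ordinary part).

References: Greenberg LNM 1716 §5 Props. 5.13–5.14 [GreenbergLNM1716]; Silverman *AEC* III.4.5, VIII.8.3 [SilvermanAEC2009].
-/

set_option linter.dupNamespace false  -- `BirchSwinnertonDyer.BirchSwinnertonDyer` is the sub's path (D-0017)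
set_option autoImplicit false

noncomputable section

open scoped Classical
open WeierstrassCurve Literature Literature.NumberTheory.EllipticCurves
  Literature.NumberTheory.EllipticCurves.Rank1Residual
  Literature.NumberTheory.EllipticCurves.Greenberg1999

namespace Summit.BirchSwinnertonDyer.BirchSwinnertonDyer.Theorems.TwoAdicOffHabitat

/-- **The `r ≤ 1` leaf shape on stratum (β) at a good ordinary `2` from the two Greenberg configurations.**  If
`corank_{ℤ₂} Sel_{2^∞} = r ⟹ r_an = r` (`r ≤ 1`) holds for every non-CM good-ordinary minimal `W` carrying a
Prop-5.14 point (M) and for every one carrying a Prop-5.13 point (R), it holds for every non-CM good-ordinary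
minimal `W` with a rational point of order `2` (a «neither» point is traded for the partner's 5.13 point).
[cite: GreenbergLNM1716, Props. 5.13–5.14 (chunks p0168–p0170)] [cite: SilvermanAEC2009, III.4 Example 4.5 and VIII.8.3] -/
theorem goodOrd_twoTorsion_leaf_of_mixed_of_ramifiedOdd
    (hM : ∀ (W : WeierstrassCurve ℚ) [W.IsElliptic] [W.IsGloballyMinimal], ¬ W.HasCM → GoodOrd W 2 →
      (∃ x : ℚ, HasRationalTwoTorsionX W x ∧
        ((TwoTorsionRamifiedAtTwo x ∧ ¬ TwoTorsionOdd W x) ∨ (TwoTorsionOdd W x ∧ ¬ TwoTorsionRamifiedAtTwo x))) →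
      ∀ r : ℕ, r ≤ 1 → W.selmerCorank 2 = r → W.analyticRank = r)
    (hR : ∀ (W : WeierstrassCurve ℚ) [W.IsElliptic] [W.IsGloballyMinimal], ¬ W.HasCM → GoodOrd W 2 →
      (∃ x : ℚ, HasRationalTwoTorsionX W x ∧ TwoTorsionRamifiedAtTwo x ∧ TwoTorsionOdd W x) →
      ∀ r : ℕ, r ≤ 1 → W.selmerCorank 2 = r → W.analyticRank = r) :
    ∀ (W : WeierstrassCurve ℚ) [W.IsElliptic] [W.IsGloballyMinimal], ¬ W.HasCM → GoodOrd W 2 →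
      (∃ P : W.toAffine.Point, P ≠ 0 ∧ 2 • P = 0) →
      ∀ r : ℕ, r ≤ 1 → W.selmerCorank 2 = r → W.analyticRank = r := by
  intro W _ _ hCM hgo hP r hr hc
  obtain ⟨x₀, y₀, hEq, h2⟩ := (exists_two_torsion_iff_exists_hasRationalTwoTorsionX W).mp hP
  by_cases hmix : (TwoTorsionRamifiedAtTwo x₀ ∧ ¬ TwoTorsionOdd W x₀) ∨
      (TwoTorsionOdd W x₀ ∧ ¬ TwoTorsionRamifiedAtTwo x₀)
  · exact hM W hCM hgo ⟨x₀, ⟨y₀, hEq, h2⟩, hmix⟩ r hr hc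
  by_cases hRO : TwoTorsionRamifiedAtTwo x₀ ∧ TwoTorsionOdd W x₀
  · exact hR W hCM hgo ⟨x₀, ⟨y₀, hEq, h2⟩, hRO⟩ r hr hc
  have hN : ¬ TwoTorsionRamifiedAtTwo x₀ ∧ ¬ TwoTorsionOdd W x₀ := by tauto
  set C : VariableChange ℚ := ⟨1, x₀, -W.a₁ / 2, y₀⟩ with hC
  have hns : W.toAffine.Nonsingular x₀ y₀ := (WeierstrassCurve.Affine.equation_iff_nonsingular).mp hEq
  have hy₀ : y₀ = W.toAffine.negY x₀ y₀ := by
    rw [WeierstrassCurve.Affine.negY]; linear_combination h2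
  haveI hNF : (C • W).IsTwoTorsionNF := isTwoTorsionNF_smul_of_two_nsmul_eq_zero two_ne_zero hns hy₀
  obtain ⟨C₀, hmin⟩ := hasGlobalMinimalModel_rat_holds (C • W).twoIsogenyCodomain
  set W' : WeierstrassCurve ℚ := C₀ • (C • W).twoIsogenyCodomain with hW'
  haveI : W'.IsGloballyMinimal := hmin
  have hlink : C₀⁻¹ • W' = (C • W).twoIsogenyCodomain := inv_smul_smul C₀ _
  haveI : (C₀⁻¹ • W').IsTwoTorsionNF := by rw [hlink]; infer_instance
  have hCr : C.r = x₀ := rfl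
  have hgo' : GoodOrd W' 2 := (goodOrd_two_iff_of_twoTorsionPair hlink).mp hgo
  have hCM' : ¬ W'.HasCM := fun h ↦ hCM ((hasCM_iff_of_twoTorsionPair hlink).mpr h)
  have ha₁ := odd_a₁_integralModelInt_of_goodOrd_or_mult W (Or.inl hgo)
  have ha₁' := odd_a₁_integralModelInt_of_goodOrd_or_mult W' (Or.inl hgo')
  have hRO' : TwoTorsionRamifiedAtTwo C₀⁻¹.r ∧ TwoTorsionOdd W' C₀⁻¹.r :=
    (neither_iff_ramified_and_odd_of_twoIsogeny W W' C C₀⁻¹ ha₁ ha₁' hlink).mp (hCr ▸ hN)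
  have hx' : HasRationalTwoTorsionX W' C₀⁻¹.r := hasRationalTwoTorsionX_of_isTwoTorsionNF_smul W' C₀⁻¹
  have h' := hR W' hCM' hgo' ⟨C₀⁻¹.r, hx', hRO'⟩ r hr
  exact (twoConverseAt_iff_of_twoTorsionPair hlink r).mpr h' hc

/-- **The `r = 1` instance** (the good-ordinary rational-`2`-torsion part of item 24404
`RankOneTwoConverseOffBigImage` = KRR2's residual 24303 at `r = 1`): (M₁) ∧ (R₁) ⟹ the (β) piece.
[cite: GreenbergLNM1716, Props. 5.13–5.14 (chunks p0168–p0170)] -/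
theorem goodOrd_twoTorsion_rankOne_of_mixed_of_ramifiedOdd
    (hM : ∀ (W : WeierstrassCurve ℚ) [W.IsElliptic] [W.IsGloballyMinimal], ¬ W.HasCM → GoodOrd W 2 →
      (∃ x : ℚ, HasRationalTwoTorsionX W x ∧
        ((TwoTorsionRamifiedAtTwo x ∧ ¬ TwoTorsionOdd W x) ∨ (TwoTorsionOdd W x ∧ ¬ TwoTorsionRamifiedAtTwo x))) →
      W.selmerCorank 2 = 1 → W.analyticRank = 1)
    (hR : ∀ (W : WeierstrassCurve ℚ) [W.IsElliptic] [W.IsGloballyMinimal], ¬ W.HasCM → GoodOrd W 2 →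
      (∃ x : ℚ, HasRationalTwoTorsionX W x ∧ TwoTorsionRamifiedAtTwo x ∧ TwoTorsionOdd W x) →
      W.selmerCorank 2 = 1 → W.analyticRank = 1) :
    ∀ (W : WeierstrassCurve ℚ) [W.IsElliptic] [W.IsGloballyMinimal], ¬ W.HasCM → GoodOrd W 2 →
      (∃ P : W.toAffine.Point, P ≠ 0 ∧ 2 • P = 0) → W.selmerCorank 2 = 1 → W.analyticRank = 1 := by
  intro W _ _ hCM hgo hP hc
  obtain ⟨x₀, y₀, hEq, h2⟩ := (exists_two_torsion_iff_exists_hasRationalTwoTorsionX W).mp hP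
  by_cases hmix : (TwoTorsionRamifiedAtTwo x₀ ∧ ¬ TwoTorsionOdd W x₀) ∨
      (TwoTorsionOdd W x₀ ∧ ¬ TwoTorsionRamifiedAtTwo x₀)
  · exact hM W hCM hgo ⟨x₀, ⟨y₀, hEq, h2⟩, hmix⟩ hc
  by_cases hRO : TwoTorsionRamifiedAtTwo x₀ ∧ TwoTorsionOdd W x₀
  · exact hR W hCM hgo ⟨x₀, ⟨y₀, hEq, h2⟩, hRO⟩ hc
  have hN : ¬ TwoTorsionRamifiedAtTwo x₀ ∧ ¬ TwoTorsionOdd W x₀ := by tauto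
  set C : VariableChange ℚ := ⟨1, x₀, -W.a₁ / 2, y₀⟩ with hC
  have hns : W.toAffine.Nonsingular x₀ y₀ := (WeierstrassCurve.Affine.equation_iff_nonsingular).mp hEq
  have hy₀ : y₀ = W.toAffine.negY x₀ y₀ := by
    rw [WeierstrassCurve.Affine.negY]; linear_combination h2
  haveI hNF : (C • W).IsTwoTorsionNF := isTwoTorsionNF_smul_of_two_nsmul_eq_zero two_ne_zero hns hy₀
  obtain ⟨C₀, hmin⟩ := hasGlobalMinimalModel_rat_holds (C • W).twoIsogenyCodomain
  set W' : WeierstrassCurve ℚ := C₀ • (C • W).twoIsogenyCodomain with hW'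
  haveI : W'.IsGloballyMinimal := hmin
  have hlink : C₀⁻¹ • W' = (C • W).twoIsogenyCodomain := inv_smul_smul C₀ _
  haveI : (C₀⁻¹ • W').IsTwoTorsionNF := by rw [hlink]; infer_instance
  have hCr : C.r = x₀ := rfl
  have hgo' : GoodOrd W' 2 := (goodOrd_two_iff_of_twoTorsionPair hlink).mp hgo
  have hCM' : ¬ W'.HasCM := fun h ↦ hCM ((hasCM_iff_of_twoTorsionPair hlink).mpr h)
  have ha₁ := odd_a₁_integralModelInt_of_goodOrd_or_mult W (Or.inl hgo)
  have ha₁' := odd_a₁_integralModelInt_of_goodOrd_or_mult W' (Or.inl hgo')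
  have hRO' : TwoTorsionRamifiedAtTwo C₀⁻¹.r ∧ TwoTorsionOdd W' C₀⁻¹.r :=
    (neither_iff_ramified_and_odd_of_twoIsogeny W W' C C₀⁻¹ ha₁ ha₁' hlink).mp (hCr ▸ hN)
  have hx' : HasRationalTwoTorsionX W' C₀⁻¹.r := hasRationalTwoTorsionX_of_isTwoTorsionNF_smul W' C₀⁻¹
  have h' := hR W' hCM' hgo' ⟨C₀⁻¹.r, hx', hRO'⟩
  exact (twoConverseAt_iff_of_twoTorsionPair hlink 1).mpr h' hc

end Summit.BirchSwinnertonDyer.BirchSwinnertonDyer.Theorems.TwoAdicOffHabitat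

end
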